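import Summits.ResolutionOfSingularities.ResolutionOfSingularities.Theorems.EquisingularLiftEquisingularLiftNatP1VBTwistedCech
import Summits.ResolutionOfSingularities.ResolutionOfSingularities.Theorems.EquisingularLiftEquisingularLiftNatP1VBLineBundleLift
import Summits.ResolutionOfSingularities.ResolutionOfSingularities.Theorems.EquisingularLiftEquisingularLiftNatP1VBProjectiveLine
import Literature.AlgebraicGeometry.Modules.SerreTwistHom
import Literature.AlgebraicGeometry.Morphisms.CechModuleRefinement
import HarnessLib

/-!
# [OURS · L1 W4.5(b) · T-P1VB part 11] The Hom-lift: `ψ₀ : g^*K → g^*M` lifts to `σ : K → M` with `g^*σ = ψ₀`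
# when `Ȟ¹(𝓗om(g^*K, g^*M)) = 0`; instance `K = 𝒪_{ℙ¹_A}(d)`

Cell res-hironaka, LADDER-RESOLUTION rung L (D-0089), slot W4.5(b), crux `Theses.EquisingularLift.EquisingularLiftNat`
(stmt-ResolutionOfSingularities-20038) / child `EquisingularLiftNatThree` (stmt-ResolutionOfSingularities-20148); object **T-P1VB**
(res-L1-w45b-lead-2 BOOK 2026-08-27T09:28:20Z; rung v8 DIR₀, supplier debt (b) of `Theorems/…NatDirZeroDefs.lean`),
`--supports stmt-ResolutionOfSingularities-20148 --as helper`. NOT a statement of any manuscript; OURS. AI-written; AI review is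
weaker than expert review.

WHAT. In the two-chart base-change setting of parts 1, 2, 10 (`f : X → Spec A` proper, `A` Noetherian local, `φ : A → B ≠ 0`
surjective, `g : Y = X ×_A B → X`, `X = U₀ ∪ U₁`, `U₀, U₁, U₀ ∩ U₁` affine; `K, M` coherent, `K` free of rank one on `U₀` and on
`U₁` — frames `κ i`, generators `b_i`, transition `twist`: `b₀| = twist • b₁|`, `gen_rel`):
* `pullback_hom_ext` — two morphisms `g^*K → N` agreeing on the pulled-back generators `η(b₀), η(b₁)` are equal;
* **`exists_pullback_map_eq`** — if `Ȟ¹((g⁻¹U₀, g⁻¹U₁); 𝓗om(g^*K, g^*M)) = 0` then EVERY `ψ₀ : g^*K → g^*M` is `g^*σ` for some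
  `σ : K → M`: the values `ψ₀(η b_i)` lift to `s_i ∈ Γ(U_i, M)` (part 1), the twisted difference `twist·s₁| − s₀|` dies
  downstairs so lies in `(ker φ)Γ(U₀ ∩ U₁, M) = δ_twist((ker φ)Č⁰)` (part 10, `δ_twist` onto), the corrected `b_i ↦ s_i` agree on
  `U₀ ∩ U₁` and glue (`Ȟ⁰ = Γ` for `𝓗om(K, M)`, tree `cechMH0EquivSections`, `SerreTwist.homOfOverTop`), and `g^*σ = ψ₀` by
  `pullback_hom_ext`;
* **`exists_pullback_map_eq_projectiveLine`** — the instance `X = ℙ¹_A`, `K = glued_A(a,b) = 𝒪(d)` (part 7), `M = F` a vector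
  bundle, cover `D₊(x₀), D₊(x₁)`: with part 7 (`L₀ ≅ g^*glued_A(a,b)` for every line bundle `L₀` on `ℙ¹_k`) and part 9
  (`Ȟ¹(𝓗om(L₀, 𝒞_k/L₀)) = 0 ⇒ Ȟ¹(𝓗om(L₀, 𝒞_k)) = 0`) this is the LIFT THEOREM of rung v8 in morphism form: the embedding
  `L₀ ↪ 𝒞_k` lifts to `σ : 𝒪(d) → 𝒞` on `ℙ¹_A` with `g^*σ` the given embedding.

References (index only): Hartshorne II.5 (p. 110), III Thm. 5.1, III §12; EGA III 4 (cohomology and base change), here by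
Nakayama on the twisted two-chart Čech complex — no completeness of `A`.
-/

noncomputable section

-- `TopCat.Presheaf`/`Scheme.Modules` are not reducible (as in Mathlib's `AlgebraicGeometry/Modules`).
set_option backward.isDefEq.respectTransparency false

open CategoryTheory AlgebraicGeometry TopologicalSpace Opposite
open Literature.AlgebraicGeometry.Morphisms Literature.AlgebraicGeometry.Modules Literature.AlgebraicGeometry

attribute [local instance] MvPolynomial.gradedAlgebra Literature.AlgebraicGeometry.Motives.ProjBaseChange.algebraBase

set_option linter.dupNamespace false -- mandated namespace `Summit.<Summit>.<Problem>` of this single-conjunct summit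

namespace Summit.ResolutionOfSingularities.ResolutionOfSingularities.Cruxes.EquisingularLiftNat.P1VB

/-! ### Morphisms out of `g^*K` are determined on the pulled-back generators -/

section HomLift

open Literature.AlgebraicGeometry.Motives in
/-- **Morphisms out of `g^*K` are determined by their values on the pulled-back generators `η(b₀), η(b₁)`**
(`K` framed on `U₀`, `U₁` covering `X`; expand a section of `g^*K` over `W ∩ g⁻¹U_i` in the pulled-back frame and use
the locality of the target). [folklore] -/
theorem pullback_hom_ext {X : Scheme.{0}} (K : X.Modules) (U : Fin 2 → X.Opens)
    (κ : ∀ i, SheafOfModules.free (Fin 1) ≅ K.over (U i)) (hcov : ⨆ i, U i = ⊤) {Y : Scheme.{0}} {g : Y ⟶ X}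
    {N : Y.Modules} (χ₁ χ₂ : (Scheme.Modules.pullback g).obj K ⟶ N)
    (h : ∀ i, χ₁.app (g ⁻¹ᵁ U i) (unitSection g K (U i) (gen K U κ i)) =
      χ₂.app (g ⁻¹ᵁ U i) (unitSection g K (U i) (gen K U κ i))) :
    χ₁ = χ₂ := by
  have hcov' : (⨆ i, g ⁻¹ᵁ U i) = ⊤ := by rw [← Scheme.Hom.preimage_iSup, hcov]; rfl
  refine Scheme.Modules.hom_ext _ _ fun W => ?_
  ext b
  refine (MSections.abSheaf N).eq_of_locally_eq' (fun i => W ⊓ g ⁻¹ᵁ U i) W (fun i => homOfLE inf_le_left) ?_ _ _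
    fun i => ?_
  · rw [← inf_iSup_eq, hcov', inf_top_eq]
  · change N.presheaf.map (homOfLE (inf_le_left : W ⊓ g ⁻¹ᵁ U i ≤ W)).op (χ₁.app W b) =
      N.presheaf.map (homOfLE (inf_le_left : W ⊓ g ⁻¹ᵁ U i ≤ W)).op (χ₂.app W b)
    rw [← Scheme.Modules.Hom.app_map_apply, ← Scheme.Modules.Hom.app_map_apply]
    -- expand `b|` in the pulled-back frame
    generalize ((Scheme.Modules.pullback g).obj K).presheaf.map (homOfLE (inf_le_left : W ⊓ g ⁻¹ᵁ U i ≤ W)).op b = b'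
    rw [eq_sum_coord_smul (pullbackFrame g (κ i)) (homOfLE inf_le_right) b', Fin.sum_univ_one,
      Scheme.Modules.Hom.app_smul, Scheme.Modules.Hom.app_smul, Scheme.Modules.Hom.app_map_apply,
      Scheme.Modules.Hom.app_map_apply, basisSection_pullbackFrame]
    change _ • N.presheaf.map _ (χ₁.app (g ⁻¹ᵁ U i) (unitSection g K (U i) (gen K U κ i))) =
      _ • N.presheaf.map _ (χ₂.app (g ⁻¹ᵁ U i) (unitSection g K (U i) (gen K U κ i)))
    rw [h i]

variable {A : Type} [CommRing A] {X : Scheme.{0}} (f : X ⟶ Spec (.of A)) (K M : X.Modules) (U : Fin 2 → X.Opens)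
  (κ : ∀ i, SheafOfModules.free (Fin 1) ≅ K.over (U i))
  {B : Type} [CommRing B] (φ : A →+* B) {Y : Scheme.{0}} {g : Y ⟶ X} {t : Y ⟶ Spec (.of B)}

/-- **The transition function of the two frames**: the coordinate of `b₀|` in the frame `b₁|` on `U₀ ∩ U₁`. [folklore] -/
def twist : Sections f (U 0 ⊓ U 1) :=
  coord (κ 1) (homOfLE (inf_le_right : U 0 ⊓ U 1 ≤ U 1))
    (K.presheaf.map (homOfLE (inf_le_left : U 0 ⊓ U 1 ≤ U 0)).op (gen K U κ 0)) 0

/-- `b₀| = twist • b₁|` (basis expansion in the rank-one frame `κ 1`). [folklore] -/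
theorem gen_rel :
    MSections.res f K inf_le_left (gen K U κ 0 : MSections f K (U 0)) =
      twist f K U κ • MSections.res f K inf_le_right (gen K U κ 1 : MSections f K (U 1)) := by
  have h := eq_sum_coord_smul (κ 1) (homOfLE (inf_le_right : U 0 ⊓ U 1 ≤ U 1))
    (K.presheaf.map (homOfLE (inf_le_left : U 0 ⊓ U 1 ≤ U 0)).op (gen K U κ 0))
  rw [Fin.sum_univ_one] at h
  exact h

/-- `evalEquiv` at the frame `κ i` is evaluation at `gen i`. [folklore] -/
theorem evalEquiv_apply_gen (i : Fin 2) (χ : MSections f (sheafHom K M) (U i)) :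
    evalEquiv f K M (κ i) χ = appLE (χ : K.over (U i) ⟶ M.over (U i)) (𝟙 (U i)) (gen K U κ i) := rfl

variable [IsNoetherianRing A] [IsLocalRing A] [Nontrivial B] [IsProper f]

include κ in
/-- **T-P1VB part 11 — the Hom-lift.** Base change `g` of a surjection `φ : A → B ≠ 0` (`A` Noetherian local) along a
proper `f : X → Spec A`; `X = U₀ ∪ U₁` with `U₀, U₁, U₀ ∩ U₁` affine; `K, M` coherent, `K` free of rank one on `U₀` and on
`U₁`. If `Ȟ¹((g⁻¹U₀, g⁻¹U₁); 𝓗om(g^*K, g^*M)) = 0`, then **every morphism `ψ₀ : g^*K → g^*M` is the pull-back `g^*σ` of a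
morphism `σ : K → M`**. Proof: the values `ψ₀(η b_i)` lift to sections `s_i ∈ Γ(U_i, M)` (part 1); the twisted difference
`u·s₁| − s₀|` dies downstairs, so lies in `(ker φ)Γ(U₀ ∩ U₁, M) = δ_u((ker φ)Č⁰)` (part 10: `δ_u` onto); correcting the `s_i`
by elements of `(ker φ)Γ(U_i, M)` (invisible downstairs) makes `b_i ↦ s_i` compatible, hence a morphism `σ` (sheaf Hom
glues: `Ȟ⁰ = Γ`); `g^*σ` and `ψ₀` agree on the generators `η(b_i)`, hence everywhere (`pullback_hom_ext`). [folklore] -/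
theorem exists_pullback_map_eq (hφ : Function.Surjective φ)
    (H : IsPullback g t f (Spec.map (CommRingCat.ofHom φ))) (hK : Coh K) (hM : Coh M)
    (hU : ∀ i, IsAffineOpen (U i)) (hU01 : IsAffineOpen (U 0 ⊓ U 1)) (hcov : ⨆ i, U i = ⊤)
    (h1 : Subsingleton (CechMH1 t (sheafHom ((Scheme.Modules.pullback g).obj K) ((Scheme.Modules.pullback g).obj M))
      (fun i => g ⁻¹ᵁ U i)))
    (ψ₀ : (Scheme.Modules.pullback g).obj K ⟶ (Scheme.Modules.pullback g).obj M) :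
    ∃ σ : K ⟶ M, (Scheme.Modules.pullback g).map σ = ψ₀ := by
  have hu := gen_rel f K U κ
  -- the values on the pulled-back generators and their lifts (part 1)
  choose s₀ hs₀ using fun i => unitSection_surjective_of_isPullback φ f hφ H M hM.loc (hU i)
    (MSections.app t ψ₀ (g ⁻¹ᵁ U i) (unitSection g K (U i) (gen K U κ i)))
  let s : CechMC0 f M U := fun i => s₀ i
  have hs : ∀ i, unitSection g M (U i) (s i) =
      MSections.app t ψ₀ (g ⁻¹ᵁ U i) (unitSection g K (U i) (gen K U κ i)) := hs₀
  -- the twisted difference dies downstairs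
  have hrel := gen_unitSection_rel f K U κ (twist f K U κ) hu (g := g) (t := t)
  simp only [gen, basisSection_pullbackFrame] at hrel
  have hδ : unitSection g M (U 0 ⊓ U 1) (twistedDelta f M U (twist f K U κ) s) = 0 := by
    rw [twistedDelta_apply, unitSection_sub, unitSection_smul' f M (t := t), unitSection_res f (t := t),
      unitSection_res f (t := t), hs, hs, MSections.res_app, MSections.res_app, ← MSections.app_smul, sub_eq_zero]
    exact congrArg (MSections.app t ψ₀ (g ⁻¹ᵁ (U 0 ⊓ U 1))) hrel.symm
  -- hence it lies in `(ker φ)Γ(U₀ ∩ U₁, M) = δ_u((ker φ)Č⁰)` (part 10)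
  have hmem : twistedDelta f M U (twist f K U κ) s ∈ RingHom.ker φ • (⊤ : Submodule A (MSections f M (U 0 ⊓ U 1))) :=
    (unitSection_eq_zero_iff_mem_smul_top φ f hφ H M hM.loc hU01 _).mp hδ
  have hsmul : RingHom.ker φ • (⊤ : Submodule A (MSections f M (U 0 ⊓ U 1))) =
      (RingHom.ker φ • (⊤ : Submodule A (CechMC0 f M U))).map (twistedDelta f M U (twist f K U κ)) := by
    rw [Submodule.map_smul'', Submodule.map_top,
      range_twistedDelta_eq_top f K M U κ (twist f K U κ) hu φ hφ H hK hM hU hU01 hcov h1]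
  rw [hsmul] at hmem
  obtain ⟨z, hz, hδz⟩ := hmem
  have hz0 : ∀ i, unitSection g M (U i) (z i) = 0 := fun i => by
    rw [unitSection_eq_zero_iff_mem_smul_top φ f hφ H M hM.loc (hU i)]
    have h2 : (z i : MSections f M (U i)) ∈
        (RingHom.ker φ • (⊤ : Submodule A (CechMC0 f M U))).map (LinearMap.proj i) := ⟨z, hz, rfl⟩
    rw [Submodule.map_smul'', Submodule.map_top] at h2
    exact Submodule.smul_mono le_rfl le_top h2
  -- corrected lifts `s' = s - z`: same values downstairs, compatible upstairs
  have hs' : ∀ i, unitSection g M (U i) ((s - z) i) =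
      MSections.app t ψ₀ (g ⁻¹ᵁ U i) (unitSection g K (U i) (gen K U κ i)) := fun i => by
    rw [Pi.sub_apply, unitSection_sub, hs, hz0, sub_zero]
  have hcompat : twist f K U κ • MSections.res f M inf_le_right ((s - z) 1) = MSections.res f M inf_le_left ((s - z) 0) := by
    rw [← sub_eq_zero, ← twistedDelta_apply, map_sub, hδz, sub_self]
  -- the local morphisms `b_i ↦ s'_i` glue
  let σi : CechMC0 f (sheafHom K M) U := fun i => (evalEquiv f K M (κ i)).symm ((s - z) i)
  have hσi : ∀ i, evalEquiv f K M (κ i) (σi i) = (s - z) i := fun i => LinearEquiv.apply_symm_apply _ _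
  have h01 : MSections.res f (sheafHom K M) (inf_le_right : U 0 ⊓ U 1 ≤ U 1) (σi 1) =
      MSections.res f (sheafHom K M) (inf_le_left : U 0 ⊓ U 1 ≤ U 0) (σi 0) := by
    apply (evalEquiv f K M (gen₀Frame K U κ)).injective
    rw [evalEquiv_apply, evalEquiv_apply, basisSection_gen₀Frame f, appLE_res_map, hu, appLE_smul_right',
      appLE_res_map, ← evalEquiv_apply_gen, ← evalEquiv_apply_gen, hσi, hσi, hcompat]
  have hglue : σi ∈ cechMH0 f (sheafHom K M) U := by
    rw [mem_cechMH0_iff]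
    intro i j
    revert i j
    refine Fin.forall_fin_two.mpr ⟨Fin.forall_fin_two.mpr ⟨rfl, h01⟩, Fin.forall_fin_two.mpr ⟨?_, rfl⟩⟩
    have h10 := congrArg (MSections.res f (sheafHom K M) (le_of_eq (inf_comm (a := U 1) (b := U 0)))) h01
    rw [MSections.res_res, MSections.res_res] at h10
    exact h10.symm
  -- the global morphism
  set σt : MSections f (sheafHom K M) ⊤ := (cechMH0EquivSections f U (sheafHom K M) hcov).symm ⟨σi, hglue⟩ with hσt
  have hres : ∀ i, MSections.res f (sheafHom K M) (le_top : U i ≤ ⊤) σt = σi i := fun i =>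
    congrFun (congrArg Subtype.val ((cechMH0EquivSections f U (sheafHom K M) hcov).apply_symm_apply ⟨σi, hglue⟩)) i
  refine ⟨SerreTwist.homOfOverTop (σt : K.over ⊤ ⟶ M.over ⊤), pullback_hom_ext K U κ hcov _ _ fun i => ?_⟩
  rw [pullback_map_app_unitSection, SerreTwist.homOfOverTop_app]
  have hval : appLE (σt : K.over ⊤ ⟶ M.over ⊤) (homOfLE (le_top : U i ≤ ⊤)) (gen K U κ i) = (s - z) i := by
    have h3 := hσi i
    rw [← hres i, evalEquiv_apply_gen, res_sheafHom_eq, appLE_restrictHom] at h3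
    rw [appLE_congr_hom _ (homOfLE le_top) (𝟙 (U i) ≫ homOfLE le_top)]
    exact h3
  rw [hval, hs']
  rfl

end HomLift

/-! ### The instance on `ℙ¹`: morphisms `g^*𝒪(d) → g^*F` lift to `𝒪(d) → F` -/

section ProjectiveLine

open Literature.AlgebraicGeometry.Motives.ProjBaseChangeRing (mapGraded irrelevant_le_map isPullback_projMap' isProper_projToSpec)

variable {A k : Type} [CommRing A] [IsNoetherianRing A] [IsLocalRing A] [CommRing k] [Nontrivial k] [Algebra A k]

/-- **T-P1VB part 11 on `ℙ¹` — the Hom-lift for the line bundles `𝒪(d) = glued_A(a,b)`.** `A` Noetherian local, `A → k` onto a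
non-zero ring, `g : ℙ¹_k → ℙ¹_A` the special fibre, `K̃ = glued_A(a,b)` the line bundle of the monomial cocycle (part 7; every
line bundle `L₀` on `ℙ¹_k`, `k` a field, is `≅ g^*K̃` for some `a, b`, `exists_iso_pullback_of_lineBundle`), `F` a vector bundle on
`ℙ¹_A`. If `Ȟ¹((D₊x₀, D₊x₁); 𝓗om(g^*K̃, g^*F)) = 0` (part 9 supplies this from `Ȟ¹(𝓗om(L₀, 𝒞_k/L₀)) = 0` for a sub-line-bundle
`L₀ ≅ g^*K̃` of `𝒞_k = g^*F`), then **every `ψ₀ : g^*K̃ → g^*F` is `g^*σ` for some `σ : K̃ → F`** — the lift of the embedding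
`L₀ ↪ 𝒞_k` to `ℙ¹_A` asked for by rung v8 DIR₀ (`Theorems/…NatDirZeroDefs`, supplier debt (b)). No completeness of `A`. [folklore] -/
theorem exists_pullback_map_eq_projectiveLine (hπ : Function.Surjective (algebraMap A k)) (a b : ℕ)
    (F : (ProjCech.PP A 1).Modules) (hF : Motives.IsVectorBundle F)
    (h1 : Subsingleton (CechMH1 (ProjCech.toSpec k 1)
      (sheafHom ((Scheme.Modules.pullback (Proj.map (mapGraded A k (Fin 2)) (irrelevant_le_map A k (Fin 2)))).obj
          (monomialCocycle A a b).glued)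
        ((Scheme.Modules.pullback (Proj.map (mapGraded A k (Fin 2)) (irrelevant_le_map A k (Fin 2)))).obj F))
      (fun i : Fin 2 => ProjCech.Dplus k 1 {i})))
    (ψ₀ : (Scheme.Modules.pullback (Proj.map (mapGraded A k (Fin 2)) (irrelevant_le_map A k (Fin 2)))).obj
        (monomialCocycle A a b).glued ⟶
      (Scheme.Modules.pullback (Proj.map (mapGraded A k (Fin 2)) (irrelevant_le_map A k (Fin 2)))).obj F) :
    ∃ σ : (monomialCocycle A a b).glued ⟶ F,
      (Scheme.Modules.pullback (Proj.map (mapGraded A k (Fin 2)) (irrelevant_le_map A k (Fin 2)))).map σ = ψ₀ := by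
  haveI : IsProper (ProjCech.toSpec A 1) := isProper_projToSpec (Fin 2) A
  have hcharts : (fun i : Fin 2 => Proj.map (mapGraded A k (Fin 2)) (irrelevant_le_map A k (Fin 2)) ⁻¹ᵁ
      ProjCech.Dplus A 1 {i}) = fun i : Fin 2 => ProjCech.Dplus k 1 {i} :=
    funext fun i => projMap_preimage_Dplus A 1 k {i}
  have h1' : Subsingleton (CechMH1 (ProjCech.toSpec k 1)
      (sheafHom ((Scheme.Modules.pullback (Proj.map (mapGraded A k (Fin 2)) (irrelevant_le_map A k (Fin 2)))).obj
          (monomialCocycle A a b).glued)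
        ((Scheme.Modules.pullback (Proj.map (mapGraded A k (Fin 2)) (irrelevant_le_map A k (Fin 2)))).obj F))
      (fun i : Fin 2 => Proj.map (mapGraded A k (Fin 2)) (irrelevant_le_map A k (Fin 2)) ⁻¹ᵁ ProjCech.Dplus A 1 {i})) := by
    rw [hcharts]; exact h1
  exact exists_pullback_map_eq (ProjCech.toSpec A 1) (monomialCocycle A a b).glued F (fun i : Fin 2 => ProjCech.Dplus A 1 {i})
    (fun i => (monomialCocycle A a b).frame i) (algebraMap A k) hπ (isPullback_projMap' A k)
    (coh_of_isVectorBundle (isFiniteLocallyFree_monomialGlued A a b).isVectorBundle) (coh_of_isVectorBundle hF)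
    (fun i => isAffineOpen_Dplus_singleton A 1 i) (isAffineOpen_Dplus_singleton_inf A 1 0 1)
    (iSup_Dplus_singleton_eq_top A 1) h1' ψ₀

end ProjectiveLine

end Summit.ResolutionOfSingularities.ResolutionOfSingularities.Cruxes.EquisingularLiftNat.P1VB

end
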